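import Summits.QuantumFields.YangMills.Theorems.IsotropyFromPowerCountingTemperedCurvatureMomentsShieldedSubseqTame
import Summits.QuantumFields.YangMills.Theorems.IsotropyFromPowerCountingCurvatureDensitiesTameSector
import Literature.Probability.LatticeModels.ONModelSpecification

/-!
# CH_n along a subsequence, II: zero-coupling steps and the full frequently-tame sector

Support file of the line `Sketch` (card `markov-shielding`) of crux `TemperedCurvatureMoments` (T, stmt-QuantumFields-17721),
reshape 2 of the registered skeleton (lead c1); sequel of `…ShieldedSubseqTame.lean` (p163367).  The skeleton's Yang–Mills
stub D' = `stub_shieldedMomentBoundSubseq` asks for the shielded moment bound CH_n ALONG SOME subsequence of the scheme.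

At a ZERO-COUPLING step (`β = 0`) Wilson's torus measure is product Haar (landed `wilsonMeasure_zero_coupling`), the links
are independent, and the renormalised curvature `c (F(τ_yŨ) − m)` reads only the links of the unit cube at `y`, which lies
inside the sup-cube of radius `R ≥ 1`; so its conditional expectation given the links based OUTSIDE that cube is the
constant `c (⟨F⟩ − m) = κ` (independence, Mathlib `condExp_indep_eq`), WHATEVER `c` and `m` — and `|κ_k|` is eventually
bounded along a tied scheme (degree-one tie).  Hence:

* `indep_cylinderEvents_pi_haar` — under product Haar, the cylinder σ-algebras of disjoint link sets are independent;
* `dependsOn_renormalisedCurvature_cube` — `c (F(τ_yŨ) − m)` depends only on the links of the sup-cube of radius `R ≥ 1`;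
* `condExp_renormalisedCurvature_zero_coupling` — at `β = 0` the shielded renormalised curvature is a.e. the constant
  `c (wilsonTorusMean − m)`;
* `shieldedMomentBoundSubseq_of_frequently_zero_coupling` — D' at `(r, sch)` for every scheme tied to `S₁` with `β_k = 0`
  FREQUENTLY (any `c_k`, `m_k`);
* `shieldedMomentBoundSubseq_of_frequently_tame` — **D' on the whole frequently-tame sector**
  `∃ B, ∃ᶠ k, β_k = 0 ∨ |c_k| ≤ B` (this file + `shieldedMomentBoundSubseq_of_frequently_bddRenormalisation`);
* `eventually_wild_of_not_shieldedMomentBoundSubseq` — contrapositive: an obstruction to D' at a tied scheme forces the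
  EVENTUALLY-WILD regime `β_k ≠ 0` eventually AND `|c_k| → ∞` — exactly the residual sector of T itself
  (`temperedCurvatureMoments_iff_wildSector` + scheme-independence of T's conclusion).

References: Osterwalder–Seiler 1978 §2 (Wilson's lattice measure); Friedli–Velenik 2017 §6.3, Georgii 2011 §1.2
(conditioning on exterior σ-algebras, Doob–Dynkin). [folklore]
-/

noncomputable section

namespace Summit.QuantumFields.YangMills.Theorems.TemperedCurvatureMoments.Sketch

open scoped BigOperators
open MeasureTheory Filter Topology ProbabilityTheory
open Literature.MathematicalPhysics.QuantumFieldTheory Literature.MathematicalPhysics.QuantumLattice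
open Literature.MathematicalPhysics.AQFT
open Literature.Probability.LatticeModels (box Site Torus.proj_apply)
open Summit.QuantumFields.YangMills.Theorems.CurvatureBoostCovariance.Negative (Tie)
open Summit.QuantumFields.YangMills.Theorems.NPointIsotropy.Negative (E4)
open Summit.QuantumFields.YangMills.Theorems.SoftKernelBoostCovariance.Sketch (eventually_abs_renormalisedMean_le)
open Summit.QuantumFields.YangMills.Theorems.LatticeGapOnTrajectory.Negative (wilsonMeasure_zero_coupling)
open Summit.QuantumFields.YangMills.Theorems.OSLegsFromFemtoAndGap (torusE_dens_eq_wilsonTorusMean)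
open Summit.QuantumFields.YangMills.Cruxes.OSLegsFromFemtoAndGap.DlrCollarTransfer (torusE dens)

variable {G : Type} [Group G] [TopologicalSpace G] [IsTopologicalGroup G] [CompactSpace G]
  [MeasurableSpace G] [BorelSpace G]

/-! ## Independence of disjoint link sets under product Haar -/

omit [Group G] [TopologicalSpace G] [IsTopologicalGroup G] [CompactSpace G] [BorelSpace G] in
/-- **Under a product of probability measures on the links, the cylinder σ-algebras of disjoint link sets are
independent** (coordinates of a product measure are independent, `iIndepFun_pi`; `indep_iSup_of_disjoint`). [folklore] -/
theorem indep_cylinderEvents_pi {S : ℕ} [NeZero S] (μ₀ : Measure G) [IsProbabilityMeasure μ₀] {A B : Set (Edge 4 S)}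
    (hAB : Disjoint A B) :
    Indep (cylinderEvents (X := fun _ : Edge 4 S => G) A) (cylinderEvents (X := fun _ : Edge 4 S => G) B)
      (Measure.pi fun _ : Edge 4 S => μ₀) := by
  have hi : iIndepFun (fun (e : Edge 4 S) (U : GaugeConfig 4 S G) => U e) (Measure.pi fun _ : Edge 4 S => μ₀) :=
    iIndepFun_pi (X := fun _ => id) fun _ => aemeasurable_id
  rw [iIndepFun_iff_iIndep] at hi
  exact indep_iSup_of_disjoint (fun e => (measurable_pi_apply e).comap_le) hi hAB

/-! ## The renormalised curvature reads only the links of the cube -/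

/-- Edges in the support of the curvature species have all base coordinates in `{0, 1}`. [folklore] -/
theorem fst_mem_Icc_of_mem_curvatureSupp (r : LatticeRep G) {e : Site 4 × Fin 4}
    (he : e ∈ r.curvature.supp) (l : Fin 4) : 0 ≤ e.1 l ∧ e.1 l ≤ 1 := by
  -- adapted from the private `fst_mem_Icc_of_mem_supp` of `…MesoOfShielded.lean`
  have hsupp : r.curvature.supp =
      Finset.univ.biUnion fun p : Fin 4 × Fin 4 => originPlaquetteSupport p.1 p.2 := rfl
  rw [hsupp, Finset.mem_biUnion] at he
  obtain ⟨p, -, hp⟩ := he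
  simp only [originPlaquetteSupport, Finset.mem_insert, Finset.mem_singleton] at hp
  rcases hp with rfl | rfl | rfl | rfl
  · simp
  · simp only [Pi.single_apply]
    split_ifs <;> simp
  · simp only [Pi.single_apply]
    split_ifs <;> simp
  · simp

/-- **Dependence.** `φ = c (F(τ_y Ũ) − m)` reads only the torus links `ℓ` with `(ℓ ν − y ν + R) mod (2L+1) ≤ 2R` for
all `ν` (the unit cube at `y` sits in the sup-cube of radius `R ≥ 1` once `R + 1 < 2L + 1`). [folklore] -/
theorem dependsOn_renormalisedCurvature_cube (r : LatticeRep G) {L R : ℕ} (hR1 : 1 ≤ R) (hRL : R + 1 < 2 * L + 1)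
    (c m : ℝ) (y : Site 4) :
    DependsOn (fun U : GaugeConfig 4 (2 * L + 1) G =>
        c * (r.curvature.F (configShift (-y) (torusLift (2 * L + 1) U)) - m))
      {ℓ : Edge 4 (2 * L + 1) | ∀ ν : Fin 4,
        (ℓ.1 ν - ((y ν : ℤ) : ZMod (2 * L + 1)) + (R : ZMod (2 * L + 1))).val ≤ 2 * R} := by
  -- adapted from the private `dependsOn_phi` of `…MesoOfShielded.lean`
  intro U V hUV
  refine congrArg (fun z : ℝ => c * (z - m)) ?_
  refine r.curvature.isCylinder fun e he => ?_
  simp only [configShift_apply, torusLift, Function.comp_apply]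
  refine hUV _ fun ν => ?_
  have hc := fst_mem_Icc_of_mem_curvatureSupp r he ν
  obtain ⟨e', he'⟩ : ∃ e' : ℕ, (e' : ℤ) = e.1 ν := ⟨(e.1 ν).toNat, Int.toNat_of_nonneg hc.1⟩
  have he1 : e' ≤ 1 := by omega
  simp only [torusEdge, Torus.proj_apply, sub_neg_eq_add, Pi.add_apply, Int.cast_add,
    add_sub_cancel_right, ← he', Int.cast_natCast]
  rw [← Nat.cast_add, ZMod.val_natCast_of_lt (by omega)]
  omega

/-! ## Zero coupling: the shielded renormalised curvature is a constant -/

/-- **At `β = 0` the shielded renormalised curvature is a.e. the constant `c (⟨F⟩ − m)`.**  For `R ≥ 1` with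
`R + 1 < 2L + 1`, any `c, m` and any site `y`: under Wilson's torus measure at zero coupling (product Haar), the
conditional expectation of `c (F(τ_yŨ) − m)` given the links based OUTSIDE the sup-cube of radius `R` around `y` equals
`c (wilsonTorusMean − m)` almost everywhere (the observable is measurable with respect to the cube's links, which are
independent of the exterior links; `condExp_indep_eq`; translation invariance `torusE_dens_eq_wilsonTorusMean`).
[folklore] -/
theorem condExp_renormalisedCurvature_zero_coupling (r : LatticeRep G) {L R : ℕ} (hR1 : 1 ≤ R)
    (hRL : R + 1 < 2 * L + 1) (c m : ℝ) (y : Site 4) :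
    (wilsonMeasure r.ρ (0 : ℝ) : Measure (GaugeConfig 4 (2 * L + 1) G))[(fun U =>
        c * (r.curvature.F (configShift (-y) (torusLift (2 * L + 1) U)) - m)) |
        cylinderEvents {ℓ : Edge 4 (2 * L + 1) | ¬ ∀ ν : Fin 4,
          (ℓ.1 ν - ((y ν : ℤ) : ZMod (2 * L + 1)) + (R : ZMod (2 * L + 1))).val ≤ 2 * R}]
      =ᵐ[(wilsonMeasure r.ρ (0 : ℝ) : Measure (GaugeConfig 4 (2 * L + 1) G))]
      fun _ => c * (wilsonTorusMean r.ρ 0 L r.curvature.F - m) := by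
  set Q : Set (Edge 4 (2 * L + 1)) := {ℓ | ∀ ν : Fin 4,
    (ℓ.1 ν - ((y ν : ℤ) : ZMod (2 * L + 1)) + (R : ZMod (2 * L + 1))).val ≤ 2 * R} with hQ
  have hQc : {ℓ : Edge 4 (2 * L + 1) | ¬ ∀ ν : Fin 4,
      (ℓ.1 ν - ((y ν : ℤ) : ZMod (2 * L + 1)) + (R : ZMod (2 * L + 1))).val ≤ 2 * R} = Qᶜ := by
    ext ℓ; simp [hQ]
  set φ : GaugeConfig 4 (2 * L + 1) G → ℝ := fun U =>
    c * (r.curvature.F (configShift (-y) (torusLift (2 * L + 1) U)) - m) with hφ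
  have hμ : (wilsonMeasure r.ρ (0 : ℝ) : Measure (GaugeConfig 4 (2 * L + 1) G)) =
      Measure.pi fun _ : Edge 4 (2 * L + 1) => haarProbability G := wilsonMeasure_zero_coupling r.ρ _
  -- measurability of `φ` with respect to the cube's links
  have hφm : Measurable φ :=
    ((r.curvature.measurable.comp ((configShift _).measurable.comp (measurable_torusLift _))).sub_const
      _).const_mul _
  have hφQ : Measurable[cylinderEvents (X := fun _ : Edge 4 (2 * L + 1) => G) Q] φ :=
    hφm.measurable_cylinderEvents_of_dependsOn (dependsOn_renormalisedCurvature_cube r hR1 hRL c m y)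
  -- independence of the cube's links from the exterior links under product Haar
  have hind : Indep (cylinderEvents (X := fun _ : Edge 4 (2 * L + 1) => G) Q)
      (cylinderEvents (X := fun _ : Edge 4 (2 * L + 1) => G) Qᶜ)
      (wilsonMeasure r.ρ (0 : ℝ) : Measure (GaugeConfig 4 (2 * L + 1) G)) := by
    rw [hμ]
    exact indep_cylinderEvents_pi (haarProbability G) disjoint_compl_right
  haveI : IsProbabilityMeasure (wilsonMeasure r.ρ (0 : ℝ) : Measure (GaugeConfig 4 (2 * L + 1) G)) :=
    isProbabilityMeasure_wilsonMeasure (d := 4) (L := 2 * L + 1) r.ρ r.continuous 0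
  have hkey := condExp_indep_eq (m₁ := cylinderEvents (X := fun _ : Edge 4 (2 * L + 1) => G) Q)
    (m₂ := cylinderEvents (X := fun _ : Edge 4 (2 * L + 1) => G) Qᶜ)
    (μ := (wilsonMeasure r.ρ (0 : ℝ) : Measure (GaugeConfig 4 (2 * L + 1) G))) (f := φ)
    cylinderEvents_le_pi cylinderEvents_le_pi hφQ.stronglyMeasurable hind
  rw [hQc]
  refine hkey.trans (Eventually.of_forall fun U => ?_)
  -- the constant: `∫ φ = c (⟨F⟩ − m)` by translation invariance on the torus
  have hmean : ∫ U, r.curvature.F (configShift (-y) (torusLift (2 * L + 1) U))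
      ∂(wilsonMeasure r.ρ (0 : ℝ) : Measure (GaugeConfig 4 (2 * L + 1) G)) =
      wilsonTorusMean r.ρ 0 L r.curvature.F := by
    have h := torusE_dens_eq_wilsonTorusMean r 0 L y
    simpa only [torusE, dens] using h
  have hint : Integrable (fun U => r.curvature.F (configShift (-y) (torusLift (2 * L + 1) U)))
      (wilsonMeasure r.ρ (0 : ℝ) : Measure (GaugeConfig 4 (2 * L + 1) G)) := by
    obtain ⟨M, hM⟩ := r.curvature.bounded
    exact Integrable.of_bound
      ((r.curvature.measurable.comp ((configShift _).measurable.comp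
        (measurable_torusLift _))).aestronglyMeasurable) M (Eventually.of_forall fun U => by
          rw [Real.norm_eq_abs]; exact hM _)
  simp only [hφ]
  rw [integral_const_mul, integral_sub hint (integrable_const m), hmean, integral_const, smul_eq_mul,
    probReal_univ, one_mul]

/-! ## D' on the frequently-zero-coupling sector and on the whole frequently-tame sector -/

/-- **D' for schemes with zero coupling frequently** (ANY `c_k, m_k`).  If the scheme is tied to `S₁` (only the
degree-one tie is used) and `β_k = 0` along a subsequence, then the subsequence form D' of CH_n holds at `(r, sch)` for
every `n > 0`: along a strictly monotone `φ` with `β_{φ k} = 0`, for each radius `ρ ∈ (0,1]` and all large `k` (so that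
`a_{φ k} ≤ ρ`, i.e. `R = ⌊ρ/a_{φ k}⌋ ≥ 1`, `a_{φ k} L_{φ k} ≥ 1` and the renormalised mean is bounded by `K`), the shielded
renormalised curvature is a.e. the constant `κ_{φ k} = c (⟨F⟩ − m)` (`condExp_renormalisedCurvature_zero_coupling`), whose
`Lⁿ` norm is `|κ_{φ k}| ≤ K ≤ (K + 1) ρ⁰`. [folklore] -/
theorem shieldedMomentBoundSubseq_of_frequently_zero_coupling (r : LatticeRep G)
    (sch : SpeciesScheme (YMSpecies G)) (S₁ : SchwingerFamily E4) (htie : Tie r sch S₁)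
    (h0 : ∃ᶠ k in atTop, sch.β k = 0) {n : ℕ} (hn : 0 < n) :
    ∃ φ : ℕ → ℕ, StrictMono φ ∧
      ∃ (C p : ℝ), 0 < C ∧ ∀ ρ : ℝ, 0 < ρ → ρ ≤ 1 → ∃ k₀ : ℕ, ∀ k : ℕ, k₀ ≤ k →
        ∀ y : Site 4, y ∈ box 4 (sch.L (φ k) / 2) →
          (∫ U, |((wilsonMeasure r.ρ (sch.β (φ k)) :
              Measure (GaugeConfig 4 (2 * sch.L (φ k) + 1) G))[(fun U =>
              sch.c r.curvature (φ k) *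
                (r.curvature.F (configShift (-y) (torusLift (2 * sch.L (φ k) + 1) U)) -
                  sch.m r.curvature (φ k))) |
              cylinderEvents {ℓ : Edge 4 (2 * sch.L (φ k) + 1) | ¬ ∀ ν : Fin 4,
                (ℓ.1 ν - ((y ν : ℤ) : ZMod (2 * sch.L (φ k) + 1)) +
                  ((⌊ρ / sch.a (φ k)⌋₊ : ℕ) : ZMod (2 * sch.L (φ k) + 1))).val ≤
                    2 * ⌊ρ / sch.a (φ k)⌋₊}]) U| ^ n
            ∂(wilsonMeasure r.ρ (sch.β (φ k)) : Measure (GaugeConfig 4 (2 * sch.L (φ k) + 1) G))) ^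
              ((n : ℝ)⁻¹) ≤ C * ρ ^ (-p) := by
  obtain ⟨φ, hφ, hφ0⟩ := extraction_of_frequently_atTop h0
  obtain ⟨K, hK⟩ := eventually_abs_renormalisedMean_le r sch S₁ htie
  obtain ⟨k₁, hk₁⟩ := eventually_atTop.1 hK
  have hK0 : 0 ≤ K := (abs_nonneg _).trans (hk₁ k₁ le_rfl)
  refine ⟨φ, hφ, K + 1, 0, by positivity, fun ρ hρ hρ1 => ?_⟩
  -- eventually along `φ`: `a ≤ ρ` and `a L ≥ 1`, and `φ k ≥ k₁`
  have hev : ∀ᶠ k in atTop, sch.a (φ k) ≤ ρ ∧ 1 ≤ sch.a (φ k) * sch.L (φ k) ∧ k₁ ≤ φ k := by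
    refine ((sch.tendsto_a.comp hφ.tendsto_atTop).eventually (eventually_le_nhds hρ)).and
      ((((sch.tendsto_L.comp hφ.tendsto_atTop).eventually (eventually_ge_atTop 1))).and
        (hφ.tendsto_atTop.eventually (eventually_ge_atTop k₁)))
  obtain ⟨k₀, hk₀⟩ := eventually_atTop.1 hev
  refine ⟨k₀, fun k hk y _ => ?_⟩
  obtain ⟨haρ, haL, hkk₁⟩ := hk₀ k hk
  have ha : 0 < sch.a (φ k) := sch.a_pos (φ k)
  set R : ℕ := ⌊ρ / sch.a (φ k)⌋₊ with hR
  have hR1 : 1 ≤ R := by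
    rw [hR, Nat.one_le_floor_iff, le_div_iff₀ ha, one_mul]
    exact haρ
  have hRL : R + 1 < 2 * sch.L (φ k) + 1 := by
    have h1 : (R : ℝ) ≤ ρ / sch.a (φ k) := Nat.floor_le (by positivity)
    have h2 : ρ / sch.a (φ k) ≤ 1 / sch.a (φ k) := div_le_div_of_nonneg_right hρ1 ha.le
    have h3 : 1 / sch.a (φ k) ≤ sch.L (φ k) := by
      rw [div_le_iff₀ ha]; linarith [mul_comm (sch.a (φ k)) (sch.L (φ k))]
    have h4 : (R : ℝ) ≤ sch.L (φ k) := h1.trans (h2.trans h3)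
    have h5 : R ≤ sch.L (φ k) := by exact_mod_cast h4
    omega
  have hβ : sch.β (φ k) = 0 := hφ0 k
  haveI : IsProbabilityMeasure (wilsonMeasure r.ρ (0 : ℝ) :
      Measure (GaugeConfig 4 (2 * sch.L (φ k) + 1) G)) :=
    isProbabilityMeasure_wilsonMeasure (d := 4) (L := 2 * sch.L (φ k) + 1) r.ρ r.continuous _
  set κ : ℝ := sch.c r.curvature (φ k) * (wilsonTorusMean r.ρ 0 (sch.L (φ k)) r.curvature.F -
    sch.m r.curvature (φ k)) with hκ
  have hκK : |κ| ≤ K := by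
    have h := hk₁ (φ k) hkk₁
    rw [hβ] at h
    exact h
  have hae := condExp_renormalisedCurvature_zero_coupling r hR1 hRL (sch.c r.curvature (φ k))
    (sch.m r.curvature (φ k)) y
  -- rewrite the coupling to `0` and replace the conditional expectation by the constant
  have hint_eq : (∫ U, |((wilsonMeasure r.ρ (sch.β (φ k)) :
        Measure (GaugeConfig 4 (2 * sch.L (φ k) + 1) G))[(fun U =>
        sch.c r.curvature (φ k) *
          (r.curvature.F (configShift (-y) (torusLift (2 * sch.L (φ k) + 1) U)) -
            sch.m r.curvature (φ k))) |
        cylinderEvents {ℓ : Edge 4 (2 * sch.L (φ k) + 1) | ¬ ∀ ν : Fin 4,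
          (ℓ.1 ν - ((y ν : ℤ) : ZMod (2 * sch.L (φ k) + 1)) +
            ((R : ℕ) : ZMod (2 * sch.L (φ k) + 1))).val ≤ 2 * R}]) U| ^ n
      ∂(wilsonMeasure r.ρ (sch.β (φ k)) : Measure (GaugeConfig 4 (2 * sch.L (φ k) + 1) G))) =
      |κ| ^ n := by
    rw [hβ, integral_congr_ae (hae.mono fun U hU => by rw [hU]), integral_const, smul_eq_mul,
      probReal_univ, one_mul]
  rw [hint_eq, neg_zero, Real.rpow_zero, mul_one, ← Real.rpow_natCast,
    ← Real.rpow_mul (abs_nonneg κ), mul_inv_cancel₀ (by exact_mod_cast hn.ne'), Real.rpow_one]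
  linarith

/-- **D' ON THE WHOLE FREQUENTLY-TAME SECTOR** `∃ B, ∃ᶠ k, β_k = 0 ∨ |c_k| ≤ B`: either `β_k = 0` frequently
(`shieldedMomentBoundSubseq_of_frequently_zero_coupling`) or `|c_k| ≤ B` frequently
(`shieldedMomentBoundSubseq_of_frequently_bddRenormalisation`, p163367).  This is the sector on which T itself is
certified (`temperedApproximants_of_eventually_tame` + scheme-independence); the k-uniform D of reshape 1 is NOT
certified there. [folklore] -/
theorem shieldedMomentBoundSubseq_of_frequently_tame (r : LatticeRep G)
    (sch : SpeciesScheme (YMSpecies G)) (S₁ : SchwingerFamily E4) (htie : Tie r sch S₁)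
    (h : ∃ B : ℝ, ∃ᶠ k in atTop, sch.β k = 0 ∨ |sch.c r.curvature k| ≤ B) {n : ℕ} (hn : 0 < n) :
    ∃ φ : ℕ → ℕ, StrictMono φ ∧
      ∃ (C p : ℝ), 0 < C ∧ ∀ ρ : ℝ, 0 < ρ → ρ ≤ 1 → ∃ k₀ : ℕ, ∀ k : ℕ, k₀ ≤ k →
        ∀ y : Site 4, y ∈ box 4 (sch.L (φ k) / 2) →
          (∫ U, |((wilsonMeasure r.ρ (sch.β (φ k)) :
              Measure (GaugeConfig 4 (2 * sch.L (φ k) + 1) G))[(fun U =>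
              sch.c r.curvature (φ k) *
                (r.curvature.F (configShift (-y) (torusLift (2 * sch.L (φ k) + 1) U)) -
                  sch.m r.curvature (φ k))) |
              cylinderEvents {ℓ : Edge 4 (2 * sch.L (φ k) + 1) | ¬ ∀ ν : Fin 4,
                (ℓ.1 ν - ((y ν : ℤ) : ZMod (2 * sch.L (φ k) + 1)) +
                  ((⌊ρ / sch.a (φ k)⌋₊ : ℕ) : ZMod (2 * sch.L (φ k) + 1))).val ≤
                    2 * ⌊ρ / sch.a (φ k)⌋₊}]) U| ^ n
            ∂(wilsonMeasure r.ρ (sch.β (φ k)) : Measure (GaugeConfig 4 (2 * sch.L (φ k) + 1) G))) ^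
              ((n : ℝ)⁻¹) ≤ C * ρ ^ (-p) := by
  obtain ⟨B, hB⟩ := h
  rw [frequently_or_distrib] at hB
  rcases hB with h0 | hc
  · exact shieldedMomentBoundSubseq_of_frequently_zero_coupling r sch S₁ htie h0 hn
  · exact shieldedMomentBoundSubseq_of_frequently_bddRenormalisation r sch S₁ htie ⟨B, hc⟩ hn

/-- **Contrapositive: an obstruction to D' forces the EVENTUALLY-WILD regime.**  If the scheme is tied to `S₁` and the
subsequence form D' of CH_n FAILS at `(r, sch, n)`, `n > 0`, then `β_k ≠ 0` for all large `k` AND `|c_k| → ∞` — the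
residual sector of T itself (non-zero coupling with divergent multiplicative renormalisation, the weak-coupling
continuum limit `c_k ≍ a_k⁻⁴` being its physical inhabitant). [folklore] -/
theorem eventually_wild_of_not_shieldedMomentBoundSubseq (r : LatticeRep G) (sch : SpeciesScheme (YMSpecies G))
    (S₁ : SchwingerFamily E4) (htie : Tie r sch S₁) {n : ℕ} (hn : 0 < n)
    (h : ¬ ∃ φ : ℕ → ℕ, StrictMono φ ∧
      ∃ (C p : ℝ), 0 < C ∧ ∀ ρ : ℝ, 0 < ρ → ρ ≤ 1 → ∃ k₀ : ℕ, ∀ k : ℕ, k₀ ≤ k →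
        ∀ y : Site 4, y ∈ box 4 (sch.L (φ k) / 2) →
          (∫ U, |((wilsonMeasure r.ρ (sch.β (φ k)) :
              Measure (GaugeConfig 4 (2 * sch.L (φ k) + 1) G))[(fun U =>
              sch.c r.curvature (φ k) *
                (r.curvature.F (configShift (-y) (torusLift (2 * sch.L (φ k) + 1) U)) -
                  sch.m r.curvature (φ k))) |
              cylinderEvents {ℓ : Edge 4 (2 * sch.L (φ k) + 1) | ¬ ∀ ν : Fin 4,
                (ℓ.1 ν - ((y ν : ℤ) : ZMod (2 * sch.L (φ k) + 1)) +
                  ((⌊ρ / sch.a (φ k)⌋₊ : ℕ) : ZMod (2 * sch.L (φ k) + 1))).val ≤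
                    2 * ⌊ρ / sch.a (φ k)⌋₊}]) U| ^ n
            ∂(wilsonMeasure r.ρ (sch.β (φ k)) : Measure (GaugeConfig 4 (2 * sch.L (φ k) + 1) G))) ^
              ((n : ℝ)⁻¹) ≤ C * ρ ^ (-p)) :
    (∀ᶠ k in atTop, sch.β k ≠ 0) ∧ Tendsto (fun k => |sch.c r.curvature k|) atTop atTop := by
  refine ⟨?_, tendsto_abs_c_of_not_shieldedMomentBoundSubseq r sch S₁ htie hn h⟩
  by_contra hnot
  rw [not_eventually] at hnot
  refine h (shieldedMomentBoundSubseq_of_frequently_zero_coupling r sch S₁ htie ?_ hn)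
  exact hnot.mono fun k hk => not_not.1 hk

end Summit.QuantumFields.YangMills.Theorems.TemperedCurvatureMoments.Sketch

end
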